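import Summits.QuantumFields.YangMills.Theorems.BalabanLadderIRRankPurityCofinalDefs
import Summits.QuantumFields.YangMills.Theorems.BalabanLadderIRScalingHeredity
import Summits.QuantumFields.YangMills.Theorems.BalabanLadderIRCofinalCouplingsSeam
import Summits.QuantumFields.YangMills.Theorems.DoublingDefectRecursionToGapIteration
import Summits.QuantumFields.YangMills.Theses.BalabanLadder
import HarnessLib

/-!
# `BalabanLadder.IR` ∕ `IRcof` helper — rank-purity under the COFINAL quantifier, part 2: per-coupling seam and compositions to `IRcof`
# (ideator ym-ir-idea-14 gen 4; `--supports stmt-QuantumFields-19354 --as helper`; sorry-free part of `Cruxes/IR/Lines/rank_purity_cofinal.lean`)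

HONESTY.  Nothing here proves the Clay Yang–Mills mass gap, a lattice gap, `IRnsc`, `IRnscCof`, `IRcof` or `BalabanLadder.IR`;
`R4` closes only the conditional finite-𝕋⁴ rung `BalabanLadder.UV`.  Every theorem below is CONDITIONAL on the named hypotheses
(K1 = the LANDED `ScalingHeredity.CofinalExitAt (1/24)` BY NAME (= `ExitsUnboundedAt (1/24)` of the cofinal leaf, `Iff.rfl`), X `AFToColdPressure`, K1ᴷ `RankExitsUnbounded`, Xᴷ `AFToRankExit`, Rᴷ `RankTailSquaring`, BLINDᴷ′ `BlindAt`),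
none of which is proved anywhere.

CONTENT (all sorry-free).  §4 `lightMultiplet_of_exit_at`: a rank-`Q` exit at the basin tolerance `1/(16·max C (max 2 (1/η)))` at scale
`S⋆ ≥ max S₀ 1` plus Rᴷ's basin clause AT ONE COUPLING give `LightMultipletPressureAt r β Q (1/S⋆)` (the per-coupling content of
`RankPurity.multipletPinned_of_exit_squaring`).  §5 `pinnedRankExitCof_of : RankExitsUnbounded → AFToRankExit → PinnedRankExitCof` (pin via the
landed `FluxCodeBlindness.pinned_of_AF`), `pinnedRankExitCof_of_pinnedRankExit`, `multipletPinnedOn_of`, `irnscCof_of_multipletPinnedOn`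
(via part 1's `gapOn_of_lightCode_pinned_onSet`), `irnscCof_of_irnsc`, `irnscCof_of`.  §6 `IRcof_of_split : IRscCof → IRnscCof →
Theses.BalabanLadder.IRcof`, `irscCof_of_K1_X` (kernel `ColdPressurePincer.gapOn_exitSet_of_af`), `IRcof_of`.
-/

set_option autoImplicit false

noncomputable section

open Filter Topology MeasureTheory
open scoped BigOperators InnerProductSpace SchwartzMap
open Literature.MathematicalPhysics.QuantumFieldTheory Literature.MathematicalPhysics.QuantumLattice
open Summit.QuantumFields.YangMills.Cruxes.OSLegsFromFemtoAndGap.DlrCollarTransfer (GapInUnits LowerBounds Q2)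
open Summit.QuantumFields.YangMills.Theorems.WeakCouplingHypercubicLimit.TraceNormColdPressure
open Summit.QuantumFields.YangMills.Cruxes.IR.FluxCodeBlindness
open Summit.QuantumFields.YangMills.Cruxes.IR.ColdPurityBridge (coldDefect)
open Summit.QuantumFields.YangMills.Cruxes.IR.ColdPressurePincer (IRsc IRnsc AFToColdPressure gapOn_exitSet_of_af)
open Summit.QuantumFields.YangMills.Theorems.DoublingDefect (defect_decay_of_recursion)
open Summit.QuantumFields.YangMills.Cruxes.IR.ScalingHeredity (CofinalExitAt)

namespace Summit.QuantumFields.YangMills.Cruxes.IR.RankPurity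

/-! ## §4 The per-coupling seam (PROVED; factored out of LINE D's `multipletPinned_of_exit_squaring`) -/

section PerBeta

variable {G : Type} [Group G] [TopologicalSpace G] [IsTopologicalGroup G] [CompactSpace G]
  [MeasurableSpace G] [BorelSpace G] [SecondCountableTopology G]

/-- **Exit at the basin tolerance + Rᴷ's basin clause AT ONE COUPLING ⇒ the W-currency at length `S⋆`.**  With `C' = max C (max 2 (1/η))`:
a rank-`Q` exit of half-side `S⋆ ≥ max S₀ 1` at tolerance `1/(16 C')` and the basin recursion on `[S₀, ∞)` at this `β` give
`LightMultipletPressureAt r β Q (1/S⋆)` (capped infimum `min (infTail) η`, `DoublingDefect.defect_decay_of_recursion`, canonical cold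
shape, propagation in the extent, padding to `Fin Q`; `C₀ = 1`, threshold `2 S⋆`). -/
theorem lightMultiplet_of_exit_at (r : LatticeRep G) {β : ℝ} (hβ0 : 0 ≤ β) {Q : ℕ} {C η : ℝ} {S₀ : ℕ}
    (hC : 0 < C) (hη : 0 < η)
    (hrec : ∀ S : ℕ, S₀ ≤ S → ∀ S' : ℕ, 2 * S ≤ S' → S' ≤ 4 * S →
      ∀ (ι : Type) [DecidableEq ι] (rr : ι → ℝ) (i₀ : ι), IsRatioDatum r.ρ β (2 * S + 1) ι rr i₀ →
        ∀ F : Finset ι, i₀ ∉ F → F.card ≤ Q → rankTail r.ρ β (2 * S + 1) rr F (coldExp S) ≤ η →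
          ∀ (ι' : Type) [DecidableEq ι'] (rr' : ι' → ℝ) (i₀' : ι'), IsRatioDatum r.ρ β (2 * S' + 1) ι' rr' i₀' →
            ∃ F' : Finset ι', i₀' ∉ F' ∧ F'.card ≤ Q ∧
              rankTail r.ρ β (2 * S' + 1) rr' F' (coldExp S') ≤ C * rankTail r.ρ β (2 * S + 1) rr F (coldExp S) ^ 2)
    {Ss : ℕ} (hSs0 : S₀ ≤ Ss) (hSs1 : 1 ≤ Ss) (hFex : RqExit r β Q (1 / (16 * max C (max 2 (1 / η)))) Ss) :
    LightMultipletPressureAt r β Q (1 / (Ss : ℝ)) := by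
  set C' : ℝ := max C (max 2 (1 / η)) with hC'def
  have hCC' : C ≤ C' := le_max_left _ _
  have hC'2 : 2 ≤ C' := (le_max_left _ _).trans (le_max_right _ _)
  have hC'η : 1 / η ≤ C' := (le_max_right _ _).trans (le_max_right _ _)
  have hC' : 0 < C' := lt_of_lt_of_le hC hCC'
  have hC'inv : C'⁻¹ ≤ η := by
    have h := inv_anti₀ (one_div_pos.2 hη) hC'η
    rwa [one_div, inv_inv] at h
  have hηC' : η ≤ C' * η ^ 2 := by
    have : (1 / η) * η ^ 2 = η := by field_simp
    nlinarith [mul_le_mul_of_nonneg_right hC'η (sq_nonneg η)]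
  -- the inductive quantity at this `β`: the achievable-tail infimum, capped at the basin radius `η`
  set δ : ℕ → ℝ := fun S => min (infTail r β Q S) η with hδ
  have hrec' : ∀ S : ℕ, S₀ ≤ S → ∀ S' : ℕ, 2 * S ≤ S' → S' ≤ 4 * S → δ S' ≤ C' * δ S ^ 2 := by
    intro S hS S' h2 h4
    by_cases hin : infTail r β Q S < η
    · have h := infTail_recursion (r := r) (Q := Q) (S := S) hβ0 hC.le (S' := S') hin
        (fun ι _ rr i₀ hd F hF hc hFη ι' _ rr' i₀' hd' =>
          hrec S hS S' h2 h4 ι rr i₀ hd F hF hc hFη ι' rr' i₀' hd')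
      have hδS : δ S = infTail r β Q S := min_eq_left hin.le
      rw [hδS]
      exact (min_le_left _ _).trans (h.trans (mul_le_mul_of_nonneg_right hCC' (sq_nonneg _)))
    · have hδS : δ S = η := min_eq_right (not_lt.1 hin)
      rw [hδS]
      exact (min_le_right _ _).trans hηC'
  have hnn : ∀ S : ℕ, S₀ ≤ S → 0 ≤ δ S := fun S _ => le_min (infTail_nonneg hβ0) hη.le
  have hex : δ Ss ≤ 1 / (16 * C') :=
    (min_le_left _ _).trans (infTail_le_of_mem hβ0 fun ι _ rr i₀ hd => hFex ι rr i₀ hd)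
  have hdec := defect_decay_of_recursion (δ := δ) hC' hrec' hnn hSs0 hSs1 hex
  have hSsR : (0 : ℝ) < Ss := by exact_mod_cast (by omega : 0 < Ss)
  refine ⟨1, zero_le_one, 2 * Ss, fun S' hS' => ?_⟩
  have hδS' := hdec S' hS'
  have hδη : δ S' < η :=
    lt_of_le_of_lt hδS' (lt_of_lt_of_le (by
      have hexp1 : Real.exp (-(((S' : ℝ) + 1) / Ss)) < 1 :=
        Real.exp_lt_one_iff.2 (by
          have : (0 : ℝ) < ((S' : ℝ) + 1) / Ss := by positivity
          linarith)
      have hi : 0 < C'⁻¹ := inv_pos.2 hC'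
      calc C'⁻¹ * Real.exp (-(((S' : ℝ) + 1) / Ss)) < C'⁻¹ * 1 := mul_lt_mul_of_pos_left hexp1 hi
        _ = C'⁻¹ := mul_one _) hC'inv)
  have hinf : infTail r β Q S' < η := by
    rcases min_lt_iff.1 hδη with h | h
    · exact h
    · exact absurd h (lt_irrefl _)
  have hδeq : δ S' = infTail r β Q S' := min_eq_left hinf.le
  rw [hδeq] at hδS'
  have hpos : 0 < C'⁻¹ * Real.exp (-(((S' : ℝ) + 1) / Ss)) := mul_pos (inv_pos.2 hC') (Real.exp_pos _)
  have hlt : infTail r β Q S' < 2 * (C'⁻¹ * Real.exp (-(((S' : ℝ) + 1) / Ss))) := by linarith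
  have hmem : 2 * (C'⁻¹ * Real.exp (-(((S' : ℝ) + 1) / Ss))) ∈ achievable r β Q S' :=
    mem_achievable_of_infTail_lt hlt
  obtain ⟨ι, hdecι, rr, i₀, hd⟩ := exists_ratioDatum r hβ0 (2 * S' + 1)
  obtain ⟨F, hF, hcard, hle⟩ := hmem ι rr i₀ hd
  have h2C : 2 * C'⁻¹ ≤ 1 := by
    rw [inv_eq_one_div]
    have := one_div_le_one_div_of_le two_pos hC'2
    linarith
  have hbase : rankTail r.ρ β (2 * S' + 1) rr F (coldExp S') ≤
      Real.exp (-(1 / (Ss : ℝ) * ((coldExp S' + 2 : ℕ) : ℝ))) := by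
    refine hle.trans ?_
    rw [← mul_assoc]
    refine (mul_le_of_le_one_left (Real.exp_pos _).le h2C).trans (Real.exp_le_exp.2 ?_)
    rw [neg_le_neg_iff, one_div_mul_eq_div, div_le_div_iff_of_pos_right hSsR]
    have h' : ((coldExp S' + 2 : ℕ) : ℝ) ≤ (S' : ℝ) + 1 := by
      have h : 2 * (coldExp S' + 2) ≤ S' + 4 := coldExp_add_two_le S'
      have : coldExp S' + 2 ≤ S' + 1 := by omega
      exact_mod_cast this
    exact h'
  obtain ⟨θ, hθ, hθsum⟩ := exists_fin_pad hd.1 F hcard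
  refine ⟨θ, hθ, fun m hm => ?_⟩
  have hmk : coldExp S' ≤ m := coldExp_le hm
  have hprop := rankTail_le_exp_of_le hd hF hmk hbase
  rw [hθsum m]
  refine (le_of_eq_of_le rfl hprop).trans ?_
  have hV : (1 : ℝ) ≤ 1 * ((2 * S' + 1 : ℕ) : ℝ) ^ 3 := by
    rw [one_mul]
    exact one_le_pow₀ (by exact_mod_cast (by omega : 1 ≤ 2 * S' + 1))
  exact le_mul_of_one_le_left (Real.exp_pos _).le hV

end PerBeta

/-! ## §5 Compositions on the nsc side (PROVED): K1ᴷ ∧ Xᴷ ⇒ PXᴷcof;  PXᴷcof ∧ Rᴷ ⇒ S⁺cof;  S⁺cof ∧ BLINDᴷ′ ⇒ N_cof -/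

/-- **K1ᴷ ∧ Xᴷ ⇒ PXᴷcof** (the pin from asymptotic freedom: `FluxCodeBlindness.pinned_of_AF` with the length function `rqLen`, then
`a β (2 S + 1) ≤ 2 T + 1` once `a β ≤ 1`). -/
theorem pinnedRankExitCof_of (hK : RankExitsUnbounded) (hX : AFToRankExit) : PinnedRankExitCof := by
  intro G _ _ _ _ hG hnsc
  letI : MeasurableSpace G := borel G
  haveI : BorelSpace G := ⟨rfl⟩
  intro r a ha ha0 hlb
  obtain ⟨Q, hQ⟩ := hK G hG hnsc r
  refine ⟨Q, fun θ hθ S₀ => ?_⟩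
  obtain ⟨T, β₆, hpin⟩ := pinned_of_AF r a ha hlb (fun β => rqLen r β Q θ S₀) (hX G hG hnsc r Q θ S₀ hθ)
  -- eventually `a β ≤ 1`
  obtain ⟨β₇, hβ₇⟩ : ∃ β₇ : ℝ, ∀ β : ℝ, β₇ ≤ β → a β ≤ 1 := by
    have hev : ∀ᶠ β in atTop, a β < 1 := ha0.eventually (gt_mem_nhds one_pos)
    obtain ⟨β₇, h⟩ := Filter.eventually_atTop.1 hev
    exact ⟨β₇, fun β hβ => (h β hβ).le⟩
  refine ⟨2 * T + 1, fun x => ?_⟩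
  obtain ⟨β, hβx, S, hS, hex⟩ := hQ θ hθ S₀ (max x (max β₆ β₇))
  have hx : x ≤ β := le_trans (le_max_left _ _) hβx
  have hβ6 : β₆ ≤ β := le_trans ((le_max_left _ _).trans (le_max_right _ _)) hβx
  have hβ7 : β₇ ≤ β := le_trans ((le_max_right _ _).trans (le_max_right _ _)) hβx
  obtain ⟨hlen0, hlenex⟩ := rqLen_spec r hS hex
  refine ⟨β, hx, rqLen r β Q θ S₀, hlen0, ?_, hlenex⟩
  have hp := hpin β hβ6
  have ha1 := hβ₇ β hβ7
  have hcast : (((2 * rqLen r β Q θ S₀ + 1 : ℕ) : ℝ)) = 2 * (rqLen r β Q θ S₀ : ℝ) + 1 := by push_cast; ring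
  rw [hcast]
  nlinarith [ha β, (ha β).le]

/-- LINE D's per-β PXᴷ implies the cofinal pinned family (take `x ↦ max x β₁`). -/
theorem pinnedRankExitCof_of_pinnedRankExit (hP : PinnedRankExit) : PinnedRankExitCof := by
  intro G _ _ _ _ hG hnsc
  letI : MeasurableSpace G := borel G
  haveI : BorelSpace G := ⟨rfl⟩
  intro r a ha ha0 hlb
  obtain ⟨Q, hQ⟩ := hP G hG hnsc r a ha ha0 hlb
  refine ⟨Q, fun θ hθ S₀ => ?_⟩
  obtain ⟨T, β₁, h⟩ := hQ θ hθ S₀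
  refine ⟨T, fun x => ?_⟩
  obtain ⟨S, hS, hpin, hF⟩ := h (max x β₁) (le_max_right _ _)
  exact ⟨max x β₁, le_max_left _ _, S, hS, hpin, fun ι _ rr i₀ hd => hF ι rr i₀ hd⟩

/-- **PXᴷcof ∧ Rᴷ ⇒ S⁺cof** (per coupling on the exit set at the basin tolerance: §4). -/
theorem multipletPinnedOn_of (hP : PinnedRankExitCof) (hR : RankTailSquaring) : MultipletPinnedOn := by
  intro G _ _ _ _ hG hnsc
  letI : MeasurableSpace G := borel G
  haveI : BorelSpace G := ⟨rfl⟩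
  intro r a ha ha0 hlb
  haveI : SecondCountableTopology G :=
    (r.continuous.isClosedEmbedding r.injective).isEmbedding.secondCountableTopology
  obtain ⟨Q, hQ⟩ := hP G hG hnsc r a ha ha0 hlb
  obtain ⟨C, η, β₀, S₀, hC, hη, hrec⟩ := hR G hG hnsc r Q
  have hC' : 0 < max C (max 2 (1 / η)) := lt_of_lt_of_le hC (le_max_left _ _)
  obtain ⟨T, hT⟩ := hQ (1 / (16 * max C (max 2 (1 / η)))) (by positivity) (max S₀ 1)
  -- the exit set at the basin tolerance, past `max β₀ 0`, with the pin
  refine ⟨Q, T, {β : ℝ | max β₀ 0 ≤ β ∧ ∃ S : ℕ, max S₀ 1 ≤ S ∧ a β * ((2 * S + 1 : ℕ) : ℝ) ≤ T ∧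
      RqExit r β Q (1 / (16 * max C (max 2 (1 / η)))) S}, fun x => ?_, ?_⟩
  · obtain ⟨β, hβx, S, hS, hpin, hex⟩ := hT (max x (max β₀ 0))
    exact ⟨β, ⟨le_trans (le_max_right _ _) hβx, S, hS, hpin, hex⟩, le_trans (le_max_left _ _) hβx⟩
  · rintro β ⟨hβ, S, hS, hpin, hex⟩
    have hββ₀ : β₀ ≤ β := le_trans (le_max_left _ _) hβ
    have hβ0 : (0 : ℝ) ≤ β := le_trans (le_max_right _ _) hβ
    have hS0 : S₀ ≤ S := le_trans (le_max_left _ _) hS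
    have hS1 : 1 ≤ S := le_trans (le_max_right _ _) hS
    refine ⟨S, hS1, ?_, lightMultiplet_of_exit_at r hβ0 hC hη
      (fun S₁ hS₁ S' h2 h4 ι _ rr i₀ hd F hF hc hFη ι' _ rr' i₀' hd' =>
        hrec β hββ₀ S₁ hS₁ S' h2 h4 ι rr i₀ hd F hF hc hFη ι' rr' i₀' hd') hS0 hS1 hex⟩
    have h1 : (S : ℝ) ≤ ((2 * S + 1 : ℕ) : ℝ) := by exact_mod_cast (by omega : S ≤ 2 * S + 1)
    exact (mul_le_mul_of_nonneg_left h1 (ha β).le).trans hpin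

/-- **S⁺cof ∧ BLINDᴷ′ ⇒ N_cof** (choose the pinned length on the cofinal set, blind it per coupling at length `κ ξ`, and run the Bset
rate seam `gapOn_of_lightCode_pinned_onSet` with pin `κ T + 1`). -/
theorem irnscCof_of_multipletPinnedOn (hW : MultipletPinnedOn) (hB : BlindAt) : IRnscCof := by
  intro G _ _ _ _ hG hnsc
  letI : MeasurableSpace G := borel G
  haveI : BorelSpace G := ⟨rfl⟩
  intro r a ha ha0 hlb
  classical
  obtain ⟨Q, T, Bset, hcof, hW'⟩ := hW G hG hnsc r a ha ha0 hlb
  obtain ⟨Q', κ, wd, β₃, hκ, hB'⟩ := hB G hG hnsc r Q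
  -- the pinned length on `Bset` (junk `1` off `Bset`)
  let ξ : ℝ → ℕ := fun β => if h : β ∈ Bset then κ * Classical.choose (hW' β h) else 1
  have hT0 : 0 ≤ T := by
    obtain ⟨β, hβB, -⟩ := hcof 0
    obtain ⟨ξ₀, hξ₀, hpin, -⟩ := hW' β hβB
    exact le_trans (mul_nonneg (ha β).le (Nat.cast_nonneg _)) hpin
  refine ⟨Bset, hcof, gapOn_of_lightCode_pinned_onSet r a ha ha0 Bset (Q := Q') (wd := wd) (ξ := ξ) (β₂ := β₃)
    (fun β hβB hβ3 => ?_) (T := (κ : ℝ) * T + 1) (β₆ := 0) (by positivity) (fun β hβB _ => ?_)⟩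
  · obtain ⟨hξ1, hpin, hLM⟩ := Classical.choose_spec (hW' β hβB)
    have hξdef : ξ β = κ * Classical.choose (hW' β hβB) := dif_pos hβB
    refine ⟨?_, ?_⟩
    · rw [hξdef]; exact one_le_mul hκ hξ1
    · rw [hξdef]; exact hB' β hβ3 _ hξ1 hLM
  · obtain ⟨hξ1, hpin, hLM⟩ := Classical.choose_spec (hW' β hβB)
    have hξdef : ξ β = κ * Classical.choose (hW' β hβB) := dif_pos hβB
    rw [hξdef]
    push_cast
    have hκ0 : (0 : ℝ) ≤ (κ : ℝ) := Nat.cast_nonneg _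
    nlinarith [mul_le_mul_of_nonneg_left hpin hκ0, ha β]

/-- N of record implies N_cof (take all couplings). -/
theorem irnscCof_of_irnsc (h : IRnsc) : IRnscCof := by
  intro G _ _ _ _ hG hnsc
  letI : MeasurableSpace G := borel G
  haveI : BorelSpace G := ⟨rfl⟩
  intro r a ha ha0 hlb
  obtain ⟨c₁, β₂, S₁, hc₁, h'⟩ := h G hG hnsc r a ha ha0 hlb
  refine ⟨Set.univ, fun x => ⟨x, Set.mem_univ _, le_rfl⟩, c₁, β₂, S₁, hc₁, fun A B => ?_⟩
  obtain ⟨C, hC⟩ := h' A B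
  exact ⟨C, fun β _ hβ S n hS hn => hC β hβ S n hS hn⟩

/-- **The nsc half of the cofinal bill: K1ᴷ ∧ Xᴷ ∧ Rᴷ ∧ BLINDᴷ′ ⇒ N_cof.** -/
theorem irnscCof_of (hK : RankExitsUnbounded) (hX : AFToRankExit) (hR : RankTailSquaring) (hB : BlindAt) : IRnscCof :=
  irnscCof_of_multipletPinnedOn (multipletPinnedOn_of (pinnedRankExitCof_of hK hX) hR) hB

/-! ## §6 The cofinal leaf BY NAME: `IRcof` from the two conjuncts; the sc conjunct from the tokens of record
(K1 = the LANDED `ScalingHeredity.CofinalExitAt (1/24)` BY NAME — no further copy of the K1 text, per crit-4 ∕ crit-1 LAND conditions) -/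

/-- **`IRscCof ∧ IRnscCof ⇒ Theses.BalabanLadder.IRcof`** (case split on `π₁`). -/
theorem IRcof_of_split (hsc : IRscCof) (hnsc : IRnscCof) : Summit.QuantumFields.YangMills.Theses.BalabanLadder.IRcof := by
  intro G _ _ _ _ hG
  letI : MeasurableSpace G := borel G
  haveI : BorelSpace G := ⟨rfl⟩
  intro r a ha ha0 hlb
  by_cases h : SimplyConnectedSpace G
  · exact hsc G hG h r a ha ha0 hlb
  · exact hnsc G hG h r a ha ha0 hlb

/-- **The sc conjunct from the tokens of record K1 ∧ X** (K1 = the landed `ScalingHeredity.CofinalExitAt (1/24)`, definitionally the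
`ExitsUnboundedAt (1/24)` of `Cruxes/IR/Lines/cofinal_leaf.lean`; kernel = the LEAD's `ColdPressurePincer.gapOn_exitSet_of_af`, verbatim the sc
branch of `CofinalLeaf.IRcof_of`). -/
theorem irscCof_of_K1_X (hK1 : CofinalExitAt (1 / 24)) (hX : AFToColdPressure) : IRscCof := by
  intro G _ _ _ _ hG hsc
  letI : MeasurableSpace G := borel G
  haveI : BorelSpace G := ⟨rfl⟩
  intro r a ha ha0 hlb
  refine ⟨{β : ℝ | 0 ≤ β ∧ ∃ L : ℕ, 8 ≤ L ∧ coldDefect r.ρ β L ≤ 1 / 24}, fun x => ?_,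
    gapOn_exitSet_of_af hX G hG r a ha ha0 hlb⟩
  obtain ⟨β, hβ, L, hL, hδ⟩ := hK1 G hG hsc r (max x 0)
  exact ⟨β, ⟨le_trans (le_max_right _ _) hβ, L, hL, hδ⟩, le_trans (le_max_left _ _) hβ⟩

/-- **The uniform cofinal bill: (K1 ∧ X) ∧ (K1ᴷ ∧ Xᴷ ∧ Rᴷ ∧ BLINDᴷ′) ⇒ `IRcof` BY NAME.** -/
theorem IRcof_of (hK1 : CofinalExitAt (1 / 24)) (hX : AFToColdPressure) (hK : RankExitsUnbounded) (hXK : AFToRankExit)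
    (hR : RankTailSquaring) (hB : BlindAt) : Summit.QuantumFields.YangMills.Theses.BalabanLadder.IRcof :=
  IRcof_of_split (irscCof_of_K1_X hK1 hX) (irnscCof_of hK hXK hR hB)


end Summit.QuantumFields.YangMills.Cruxes.IR.RankPurity
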